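import Mathlib
import HarnessLib
import Summits.ResolutionOfSingularities.ResolutionOfSingularities.Theorems.WildQuotientsWildQuotientResolutionS1aNodeAway
import Summits.ResolutionOfSingularities.ResolutionOfSingularities.Theorems.WildQuotientsWildQuotientResolutionS1aGoodShrink
import Summits.ResolutionOfSingularities.ResolutionOfSingularities.Theorems.WildQuotientsWildQuotientResolutionS1aNodeAtlas

/-!
# S1a — NODE CHARTS SHRINK TO INVARIANT BASIC OPENS (scheme level of `…S1aNodeAway`)

[OURS · L1 W4.5c · lead-1 g8; infrastructure for `PrincipalCentreChartShrink` (support form) / `KillableAtOfIdle` / (A3)] — NOT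
statements of the manuscript; counted 0; AI-level work, weaker than expert review. Crux stmt-ResolutionOfSingularities-17941, line
`s1a-logminvertex` v6. Route-independent.

For an action `ρ` over `q : V → Y`, a `G`-stable open `O` affine over `Y` with node data `(B, 𝒜, σ, e : Γ(V,O) ≃ 𝒜 0)` intertwining the
`g₀`-action with `σ`, and a `G`-invariant section `b ∈ Γ(V, O)`:
* `basicOpenStable ρ O hOaff hb : ρ.StableAffineOpens` — the invariant basic open `D(b)` (stable by `preimage_basicOpen_of_invariant`,
  affine over `Y` through `O`);
* `basicOpenNodeEquiv … : Γ(V, D(b)) ≃+* (B[h⁻¹])₀`, `h = e b` (Mathlib `IsAffineOpen.isLocalization_basicOpen` + `NodeAway.awayZeroEquiv`),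
  with the pin `coe_basicOpenNodeEquiv_map` (restriction of `t ∈ Γ(V,O)` ↦ `e t / 1`);
* `coe_basicOpenNodeEquiv_act` — it intertwines the `g₀`-action on `Γ(V, D(b))` with `NodeAway.sigmaAway σ _`;
* **`isNodeChart_basicOpen`** — `IsNodeChart p ρ g₀ O →` (`b` invariant) `→ IsNodeChart p ρ g₀ D(b)`, through the EXPLICIT data
  `(B[h⁻¹], locPiece, sigmaAway, basicOpenNodeEquiv)` (`exists_nodeData_basicOpen` records the data with its pins, incl. a KILLED clause:
  `(augmentationIdeal σ).IsPrincipal → (augmentationIdeal σ_h).IsPrincipal`).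
-/

set_option linter.dupNamespace false

noncomputable section

open CategoryTheory AlgebraicGeometry TopologicalSpace
open Literature.AlgebraicGeometry.Resolution Literature.AlgebraicGeometry.RelativeSpec
open Summit.ResolutionOfSingularities.ResolutionOfSingularities.Theorems.WildQuotientResolution.S1
open Summit.ResolutionOfSingularities.ResolutionOfSingularities.Theorems.WildQuotientResolution.S1.NodeAtlas
open Summit.ResolutionOfSingularities.ResolutionOfSingularities.Theorems.WildQuotientResolution.S1.GradedLocalization
open Summit.ResolutionOfSingularities.ResolutionOfSingularities.Theorems.WildQuotientResolution.S1.ProducerStep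
open Summit.ResolutionOfSingularities.ResolutionOfSingularities.Theorems.WildQuotientResolution.S1.GoodCharts
open Summit.ResolutionOfSingularities.ResolutionOfSingularities.Theorems.WildQuotientResolution.S1.NodeAway

namespace Summit.ResolutionOfSingularities.ResolutionOfSingularities.Theorems.WildQuotientResolution.S1.NodeChartAway

universe u v

section Chart

variable {V Y : Scheme.{u}} {q : V ⟶ Y} {G : Type u} [Group G] (ρ : ActionOver q G) (O : ρ.StableAffineOpens)
  (hOaff : IsAffineOpen O.1) {b : Γ(V, O.1)} (hb : ∀ g : G, actO ρ O g b = b)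

/-- **The invariant basic open `D(b)` as a `G`-stable open affine over the base.** [OURS · L1 W4.5c] -/
def basicOpenStable : ρ.StableAffineOpens :=
  ⟨V.basicOpen b, preimage_basicOpen_of_invariant ρ O hb, by
    haveI : IsAffine (V.basicOpen b : V.Opens) := hOaff.basicOpen b
    haveI : IsAffine (O.1 : V.Opens) := hOaff
    haveI := O.2.2
    have : (V.basicOpen b).ι ≫ q = V.homOfLE (V.basicOpen_le b) ≫ (O.1.ι ≫ q) := by
      rw [← Category.assoc, Scheme.homOfLE_ι]
    rw [this]
    infer_instance⟩

/-- The underlying open of `basicOpenStable` is `D(b)`. -/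
@[simp] theorem basicOpenStable_val : (basicOpenStable ρ O hOaff hb).1 = V.basicOpen b := rfl

/-- `D(b)` is affine. -/
theorem isAffineOpen_basicOpenStable : IsAffineOpen (basicOpenStable ρ O hOaff hb).1 := hOaff.basicOpen b

/-- `D(b) ⊆ O`. -/
theorem basicOpenStable_le : (basicOpenStable ρ O hOaff hb).1 ≤ O.1 := V.basicOpen_le b

/-- Membership in `D(b)`: `v ∈ O` and `b(v) ≠ 0`. -/
theorem mem_basicOpenStable_iff {v : V} (hv : v ∈ O.1) :
    v ∈ (basicOpenStable ρ O hOaff hb).1 ↔ IsUnit (V.presheaf.germ O.1 v hv b) :=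
  V.mem_basicOpen b v hv

variable {ι : Type v} [AddCommGroup ι] [DecidableEq ι] {B : Type u} [CommRing B] (𝒜 : ι → AddSubgroup B) [GradedRing 𝒜]
  (e : Γ(V, O.1) ≃+* ↥(𝒜 0))

variable (b) in
/-- **`Γ(V, D(b)) ≃+* (B[h⁻¹])₀`, `h = e b`.** [OURS · L1 W4.5c] -/
def basicOpenNodeEquiv : letI := locGradedRing 𝒜 (e b).2; Γ(V, V.basicOpen b) ≃+* ↥(locPiece 𝒜 (e b).2 0) :=
  letI := locGradedRing 𝒜 (e b).2
  haveI : IsLocalization.Away b Γ(V, V.basicOpen b) := hOaff.isLocalization_basicOpen b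
  (IsLocalization.algEquiv (Submonoid.powers b) Γ(V, V.basicOpen b) (Localization.Away b)).toRingEquiv.trans
    (awayZeroEquiv 𝒜 e b)

/-- Pin: on restrictions of sections of `O`, `basicOpenNodeEquiv (t|_{D(b)}) = e t / 1`. -/
theorem coe_basicOpenNodeEquiv_map (t : Γ(V, O.1)) :
    letI := locGradedRing 𝒜 (e b).2
    ((basicOpenNodeEquiv ρ O hOaff b 𝒜 e (algebraMap Γ(V, O.1) Γ(V, V.basicOpen b) t) :
        ↥(locPiece 𝒜 (e b).2 0)) : Localization.Away ((e b : ↥(𝒜 0)) : B)) =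
      algebraMap B _ ((e t : ↥(𝒜 0)) : B) := by
  letI := locGradedRing 𝒜 (e b).2
  haveI : IsLocalization.Away b Γ(V, V.basicOpen b) := hOaff.isLocalization_basicOpen b
  change ((awayZeroEquiv 𝒜 e b ((IsLocalization.algEquiv (Submonoid.powers b) Γ(V, V.basicOpen b)
    (Localization.Away b)) (algebraMap Γ(V, O.1) _ t)) : ↥(locPiece 𝒜 (e b).2 0)) : Localization.Away ((e b : ↥(𝒜 0)) : B)) = _
  rw [AlgEquiv.commutes]
  exact coe_awayZeroEquiv_algebraMap 𝒜 e b t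

/-- The `g₀`-action on `Γ(V, D(b))` extends the `g₀`-action on `Γ(V, O)` (naturality of `appLE`). -/
theorem act_basicOpen_algebraMap (g₀ : G) (t : Γ(V, O.1)) :
    (ρ.aut g₀⁻¹).hom.appLE (V.basicOpen b) (V.basicOpen b)
        (preimage_basicOpen_of_invariant ρ O hb g₀⁻¹).ge (algebraMap Γ(V, O.1) Γ(V, V.basicOpen b) t) =
      algebraMap Γ(V, O.1) Γ(V, V.basicOpen b) (actO ρ O g₀ t) := by
  change ((V.presheaf.map (homOfLE (V.basicOpen_le b)).op) ≫ (ρ.aut g₀⁻¹).hom.appLE _ _ _) t =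
    ((ρ.aut g₀⁻¹).hom.appLE O.1 O.1 _ ≫ V.presheaf.map (homOfLE (V.basicOpen_le b)).op) t
  rw [Scheme.Hom.map_appLE, Scheme.Hom.appLE_map]

/-- **Intertwining on `D(b)`**: if `e` intertwines the `g₀`-action on `Γ(V, O)` with `σ`, then `basicOpenNodeEquiv` intertwines the
`g₀`-action on `Γ(V, D(b))` with `σ_h = sigmaAway σ _`. [OURS · L1 W4.5c] -/
theorem coe_basicOpenNodeEquiv_act (σ : B ≃+* B) (g₀ : G)
    (hσ : ∀ t : Γ(V, O.1), ((e (actO ρ O g₀ t) : ↥(𝒜 0)) : B) = σ ((e t : ↥(𝒜 0)) : B))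
    (t' : Γ(V, V.basicOpen b)) :
    letI := locGradedRing 𝒜 (e b).2
    ((basicOpenNodeEquiv ρ O hOaff b 𝒜 e
        ((ρ.aut g₀⁻¹).hom.appLE (V.basicOpen b) (V.basicOpen b)
          (preimage_basicOpen_of_invariant ρ O hb g₀⁻¹).ge t') : ↥(locPiece 𝒜 (e b).2 0)) : Localization.Away ((e b : ↥(𝒜 0)) : B)) =
      sigmaAway σ (show σ ((e b : ↥(𝒜 0)) : B) = (e b : ↥(𝒜 0)) by rw [← hσ b, hb g₀])
        ((basicOpenNodeEquiv ρ O hOaff b 𝒜 e t' : ↥(locPiece 𝒜 (e b).2 0)) : Localization.Away ((e b : ↥(𝒜 0)) : B)) := by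
  letI := locGradedRing 𝒜 (e b).2
  haveI : IsLocalization.Away b Γ(V, V.basicOpen b) := hOaff.isLocalization_basicOpen b
  -- transfer the action to `Localization.Away b`
  let L := Localization.Away b
  let φ : Γ(V, V.basicOpen b) ≃ₐ[Γ(V, O.1)] L :=
    IsLocalization.algEquiv (Submonoid.powers b) Γ(V, V.basicOpen b) L
  let τ' : Γ(V, V.basicOpen b) →+* Γ(V, V.basicOpen b) :=
    ((ρ.aut g₀⁻¹).hom.appLE (V.basicOpen b) (V.basicOpen b) (preimage_basicOpen_of_invariant ρ O hb g₀⁻¹).ge).hom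
  let act' : L →+* L := ((φ : _ ≃ₐ[Γ(V, O.1)] L) : _ →+* L).comp (τ'.comp ((φ.symm : L ≃ₐ[Γ(V, O.1)] _) : L →+* _))
  have hact' : ∀ t : Γ(V, O.1), act' (algebraMap Γ(V, O.1) L t) = algebraMap Γ(V, O.1) L (actO ρ O g₀ t) := by
    intro t
    change φ (τ' (φ.symm (algebraMap Γ(V, O.1) L t))) = _
    rw [AlgEquiv.commutes, show τ' (algebraMap Γ(V, O.1) _ t) = algebraMap Γ(V, O.1) _ (actO ρ O g₀ t) from
      act_basicOpen_algebraMap ρ O hb g₀ t, AlgEquiv.commutes]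
  have key := coe_awayZeroEquiv_intertwine 𝒜 e b σ (actO ρ O g₀) hσ (hb g₀) act' hact' (φ t')
  have h1 : act' (φ t') = φ (τ' t') := by
    change φ (τ' (φ.symm (φ t'))) = _
    rw [AlgEquiv.symm_apply_apply]
  rw [h1] at key
  exact key

/-- **THE NODE DATA OF `D(b)`**, with pins: the localised node `(B[h⁻¹], locPiece, σ_h)`, the identification `basicOpenNodeEquiv`, the
intertwining, and the KILLED clause. [OURS · L1 W4.5c] -/
theorem exists_nodeData_basicOpen {p : ℕ} (g₀ : G) (σ : B ≃+* B) (hnode : IsTameNode p B 𝒜 σ)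
    (hσ : ∀ t : Γ(V, O.1), ((e (actO ρ O g₀ t) : ↥(𝒜 0)) : B) = σ ((e t : ↥(𝒜 0)) : B)) :
    ∃ hσb : σ ((e b : ↥(𝒜 0)) : B) = (e b : ↥(𝒜 0)),
      @IsTameNode p ι _ _ (Localization.Away ((e b : ↥(𝒜 0)) : B)) _ (locPiece 𝒜 (e b).2) (locGradedRing 𝒜 (e b).2)
          (sigmaAway σ hσb) ∧
      (letI := locGradedRing 𝒜 (e b).2
       ∀ t' : Γ(V, V.basicOpen b),
        ((basicOpenNodeEquiv ρ O hOaff b 𝒜 e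
            ((ρ.aut g₀⁻¹).hom.appLE (V.basicOpen b) (V.basicOpen b)
              (preimage_basicOpen_of_invariant ρ O hb g₀⁻¹).ge t') : ↥(locPiece 𝒜 (e b).2 0)) :
            Localization.Away ((e b : ↥(𝒜 0)) : B)) =
          sigmaAway σ hσb ((basicOpenNodeEquiv ρ O hOaff b 𝒜 e t' : ↥(locPiece 𝒜 (e b).2 0)) :
            Localization.Away ((e b : ↥(𝒜 0)) : B))) ∧
      ((augmentationIdeal σ).IsPrincipal → (augmentationIdeal (sigmaAway σ hσb)).IsPrincipal) := by
  have hσb : σ ((e b : ↥(𝒜 0)) : B) = (e b : ↥(𝒜 0)) := by rw [← hσ b, hb g₀]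
  exact ⟨hσb, isTameNode_away σ hσb 𝒜 (e b).2 hnode, fun t' => coe_basicOpenNodeEquiv_act ρ O hOaff hb 𝒜 e σ g₀ hσ t',
    isPrincipal_augmentationIdeal_sigmaAway σ hσb⟩

end Chart

/-! ## Node charts shrink -/

section NodeChart

variable {V Y : Scheme.{u}} {q : V ⟶ Y} {G : Type u} [Group G] {ρ : ActionOver q G} {g₀ : G} {p : ℕ}

/-- **NODE CHARTS SHRINK TO INVARIANT BASIC OPENS**: if `O` is a node chart and `b ∈ Γ(V, O)` is `G`-invariant, the basic open `D(b)` is a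
node chart (node `(B[h⁻¹], locPiece, σ_h)`, `h = e b`). [OURS · L1 W4.5c] -/
theorem isNodeChart_basicOpen {O : ρ.StableAffineOpens} (hO : IsNodeChart p ρ g₀ O) {b : Γ(V, O.1)}
    (hb : ∀ g : G, actO ρ O g b = b) : IsNodeChart p ρ g₀ (basicOpenStable ρ O hO.1 hb) := by
  obtain ⟨hOaff, m, r, B, _, 𝒜, _, σ, e, hnode, hσ⟩ := hO
  obtain ⟨hσb, hnode', hσ', -⟩ := exists_nodeData_basicOpen ρ O hOaff hb 𝒜 e g₀ σ hnode hσ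
  letI := locGradedRing 𝒜 (e b).2
  exact ⟨isAffineOpen_basicOpenStable ρ O hOaff hb, m, r, Localization.Away ((e b : ↥(𝒜 0)) : B), inferInstance,
    locPiece 𝒜 (e b).2, locGradedRing 𝒜 (e b).2, sigmaAway σ hσb, basicOpenNodeEquiv ρ O hOaff b 𝒜 e, hnode', hσ'⟩

/-- **A node chart has arbitrarily small node sub-charts** through any of its points, inside any `G`-stable open (`G` finite).
[OURS · L1 W4.5c] -/
theorem exists_isNodeChart_le [Finite G] {O : ρ.StableAffineOpens} (hO : IsNodeChart p ρ g₀ O) {v : V} (hv : v ∈ O.1)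
    (U : V.Opens) (hU : ∀ g : G, (ρ.aut g).hom ⁻¹ᵁ U = U) (hvU : v ∈ U) :
    ∃ O'' : ρ.StableAffineOpens, v ∈ O''.1 ∧ O''.1 ≤ O.1 ∧ O''.1 ≤ U ∧ IsNodeChart p ρ g₀ O'' := by
  obtain ⟨b, hb, hvb, hbU⟩ := exists_invariant_basicOpen ρ O hO.1 hv U hU hvU
  exact ⟨basicOpenStable ρ O hO.1 hb, hvb, V.basicOpen_le b, hbU, isNodeChart_basicOpen hO hb⟩

end NodeChart

end Summit.ResolutionOfSingularities.ResolutionOfSingularities.Theorems.WildQuotientResolution.S1.NodeChartAway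

end
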